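import Literature.MathematicalPhysics.QuantumFieldTheory.Balaban1983to89.B9Cor35CinvAtCubeLetters
import Literature.MathematicalPhysics.QuantumFieldTheory.Balaban1983to89.B9Cor36GpCubeExtAtV

/-!
# `Balaban1983to89.B9Cor36CinvCubeAtLocCfg` — COROLLARY 3.6 p. 408 FOR THE CUBE LETTER `C_□ = (Q′_□G′_□²Q′_□*)⁻¹` AT THE LOCALISED FIELD `Ṽ_□ = e^{iηχ̃_□A}·1` OF THE
# (3.35) DATUM: E2-4d's `cor35_Cinv_cube` with its nine `A`-readings DISCHARGED in currency A (no unitarity of `Ṽ_□`), and the perturbative block-local two-space majorants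
# of `Q′_□(Ṽ_□)`, `Q′_□*(Ṽ_□)` — the inputs `hunit`, `hC` (cube side), `hQ`, `hQs` of FILES E2-1 ∕ E2-2 ∕ E2-5b-1 (sub-row G-B9-LETTERS, module M5.2-E, FILE E2-5b-3;
# design (β) of `lit-balaban-p21/M52E-DESIGN-p21.md`)

T. Bałaban, *Propagators for lattice gauge theories in a background field*, Commun. Math. Phys. **99** (1985) 389–434
[`Balaban1985BackgroundPropagators`, "B9"]; [4] = T. Bałaban, *Propagators and renormalization transformations for lattice gauge
theories. II*, Commun. Math. Phys. **96** (1984) 223–250 [`Balaban1984PropagatorsII`].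

statement-level skeleton of published theorems with citation tags; proofs where landed; nothing here is a claim about the
Yang–Mills mass gap

THE PRINTED LOCUS (verbatim, held `paper:balaban1985-cmp99-background-propagators`, journal page = PDF page + 388).  Cor. 3.6 p. 408 l. 3–9: *«Applying the gauge
transformation u we get U′ = U^u = e^{iηA} with A satisfying the inequalities in (3.35) for j = k. This implies that U′ satisfies (3.37) for the sequence {Ω′_j} with U = 1 and
α₁ = O(1)Mα₀ … All the results of these theorems are gauge invariant, so they hold for the configuration U also»*; p. 409 l. 1–5 (*«the sequence {Ω_n(□)} satisfies the
assumptions of Corollary 3.6. The operators constructed for this sequence, which we denote by G′_□(U), C_□(U) = (Q′(U)G′²_□(U)Q′\*(U))⁻¹, … satisfy all the inequalities of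
Theorems 3.1–3.3 correspondingly»*); Thm 3.4 p. 400 with p. 403 l. 8–12 (*«The inverse satisfies Theorem 3.2»*); (3.57) p. 401, (3.58)–(3.59) p. 402 (*«|F′₂λ| ≦ O(1)α₁Q̃′|λ|»*);
(3.35)–(3.37) p. 396; Thm 3.2 (3.48) p. 398; [4] Prop. 2.3 (2.86)–(2.87) p. 238, (2.51) p. 232.

WHY THIS FILE.  E2-4d (`B9Cor35CinvAtCubeLetters.cor35_Cinv_cube`) is Theorem 3.4's C-clause at the cube with NINE `A`-dependent readings displayed (seven (3.37)∕(3.59) readings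
of `χ̃_□A` and the two pointwise (3.59) sizes of `Q′_□(Ṽ_□) − Q′_□(1)`, `Q′_□*(Ṽ_□) − Q′_□*(1)`).  p33's `B9Cor36GpCubeExtAtV.gp_cube_at_locCfg` discharged the `G′_□`-sector
analogue from the (3.35) datum; THIS FILE does the same for `C_□`, mirroring that proof line by line: the five (3.37) readings by p33's `readings337_locFld`, the kernel sizes by
`ownLevel_of_blockwise` + `norm_kFCubeY_parSymY_le ∕ norm_sFCubeY_parSymY_le`, and the two `Q′`-sizes by r05's CURRENCY-A `norm_QpCubeY_prod_sub_apply_le ∕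
norm_QpsCubeY_prod_sub_apply_le` — which bound `Q′_□(e^{iηa}·1) − Q′_□(1)` from the blockwise (3.37) smallness `η‖a‖ ≦ α₁L^{−n}` ALONE, so that no unitarity of
`Ṽ_□ = e^{iηχ̃_□A}·1` (not derivable from `Reg335Cube` in the abstract normed algebra `𝔸`) is needed anywhere in the C-junction:
* §1 `parSymY_one_contractive`; ★ `hasMajorantHom_conjHom_QpCubeY_of_size` ∕ ★ `hasMajorantHom_conjHom_QpsCubeY_of_size` — `conjHom b(Q′_□(Ṽ)|_ℝ) ≺ M₂Σ‖b‖(1 + τ)·𝟙`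
  from `Q′_□(Ṽ) = Q′_□(1) + F′₂` (E2-4a at `U = 1`, E2-4c from a pointwise size `τ`) — the `hQ`∕`hQs` binders of FILE E2-5b-1;
* §2 ★★★ `cinv_cube_at_locCfg` — at the datum: `IsUnit X̂_□(Ṽ_□)` (E2-1's `hunit`), the (3.48) block majorant `conj b(η⁻⁴C_□(Ṽ_□)|_ℝ) ≺ B·ℓ(a)^{−4}·e^{−δd}` over
  `(toB6 (geoCK i □) Rr H, Prod.fst)` (E2-2's ∕ E2-5b-1's `hC`), and the two majorants of §1 at `τ = C_q·α₁`, `α₁ = max C (C(1+D₁θ))·Λ²`; constants `(δ, B, M₀, T₀, N₀, a₁)` those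
  of E2-4d at `C_q := C_q(d)` of p33's `B9Eq359CubeKernelsAtOne`, uniform in the member and the cube.

HONEST SCOPE.  Assembly of landed estimates; the (3.35) datum (`Q ⊇ NearC(35S_j/8 + 1)`, `‖A‖ ≦ Cξ⁻¹`, `‖η⁻¹∂A‖ ≦ Cξ⁻²`, `ξ ≦ 5S_jη`, `L^{j+1}η ≦ Λξ`), the smallness
`α₁ ≦ min(a₁, 1/4)` (print: «α₁ = O(1)Mα₀ sufficiently small») and the member thresholds are displayed hypotheses exactly as in p33's `gp_cube_at_locCfg`; `[NormOneClass 𝔸]`.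
WHICH class cube supplies the datum (cell erratum N-c5-7, p33 memo (Q1)) is not decided here.  Count-neutral; no summit ∕ sub-problem statement is proved; nothing continuum ∕ OS ∕
mass-gap ∕ Clay; NOT a node discharge.  No `sorry`, no `axiom`, no `… : Prop` fact, no `instance`, no `notation`, no `def`.  NEW file; nothing landed is modified.  Cell
`lit-balaban`, seat `lit-balaban-p21` gen 35, 2026-08-28; `--supports stmt-QuantumFields-19200` as helper.  Net new unproved facts: 0.

RELATED IN THE TREE, NOT DUPLICATED (searched 2026-08-28: `lean search 'cinv_cube_at|conjHom_QpCubeY_of_size' --decl` = ∅): p33 `B9Cor36GpCubeExtAtV.gp_cube_at_locCfg` (the `G′_□`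
twin — pattern mirrored; its `hasMajorant_GpVK` is the `hG` input downstream), `B9Cor36CubeCutoffs` (`readings337_locFld`, `locCfgY`), `B9Eq359CubeKernelsAtOne`; p21 E2-4d
`B9Cor35CinvAtCubeLetters` (USED BY NAME), E2-4a `B9Cor36CubeSandwichQ`, E2-4c `B9Eq357CubeQpDiffMajorant`; r05 `B9Eq357CubeLetters` (currency-A sizes) — no existing module modified.
-/

noncomputable section

namespace Literature.MathematicalPhysics.QuantumFieldTheory.Balaban1983to89.B9Cor36CinvCubeAtLocCfg

open B4PartitionUnity22 (thetaProf D1)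
open B6RandomWalk (HasMajorant hasMajorant_mono)
open B6RandomWalkHom (HasMajorantHom hasMajorantHom_mono hasMajorantHom_add)
open B9Thm34Ext (toB6)
open B9Eq352DivFormLetters (conj)
open B9Eq376POneLetters (conjHom)
open B9Eq39Adjoint (fluct covD covDstar)
open B9Eq352DivForm (tauB)
open B6KLevelCensusIndexV1 (KIdx kGeo)
open B6Cover236MultiLevelBlocks (cubes)
open B6GlobalChartV1 (PV boxEquiv)
open B9BackgroundsKLevelV1 (shiftsV1)
open B9Eq360DeltaPrimeAY (mulY AfldY chartA)
open B9Eq360DeltaPrimeACubeY (blkCubeY kQCubeY sQCubeY kFCubeY sFCubeY levCubeY_eq)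
open B9CubeLettersOpsL0 (cubeFamY levCubeY)
open B9CubeLettersBondOpsL0 (BlkCubeY qpKc qpsKc QpCubeY QpsCubeY XCubeY XinvCubeY)
open B9CubeGeometryInputs (geoCK geoCK_len geoCK_eta geoCK_eta_pos geoCK_len_blkCubeY RM1)
open B9Cor35CinvAtCubeLetters (cor35_Cinv_cube)
open B9Cor36CutoffField337 (cutFldY)
open B9Cor36CubeCutoffs (SC NearC chiTY locCfgY readings337_locFld scaleLen_levCubeY_bounds)
open B9Eq359CubeKernelsAtOne (Cq Cq_nonneg norm_kFCubeY_parSymY_le norm_sFCubeY_parSymY_le ownLevel_of_blockwise)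
open B9Eq357CubeLetters (norm_QpCubeY_prod_sub_apply_le norm_QpsCubeY_prod_sub_apply_le)
open B9Eq357CubeQpDiffMajorant (conjHom_restrictScalars_eq_add hasMajorantHom_conjHom_QpCubeY_sub hasMajorantHom_conjHom_QpsCubeY_sub)
open B9Cor36CubeSandwichQ (hasMajorantHom_conjHom_QpCubeY hasMajorantHom_conjHom_QpsCubeY)
open Node00 (SiteY CfgY SiteParY toKT shiftY parSymY parSymY_one)

variable {d ℓ : ℕ} {hd : 1 ≤ d + 1} {hL : Odd (ℓ + 1) ∧ 1 < ℓ + 1} {b₀ b₁ : ℝ}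
variable {𝔸 : Type} [NormedRing 𝔸] [NormedAlgebra ℂ 𝔸] [CompleteSpace 𝔸]
variable {ι : Type} [Fintype ι] (b : Module.Basis ι ℝ 𝔸)

/-! ## §1 The two-space majorants of `Q′_□(Ṽ_□)`, `Q′_□*(Ṽ_□)` at the localised field, perturbatively ((3.57)–(3.59), currency A) -/

section QLetters

variable [NormOneClass 𝔸] (i : KIdx d ℓ hd hL b₀ b₁) (c : ↥(cubes (toKT i).D.toDomains)) {Rr : ℝ} {Hp : Prop}

/-- the base transporters at `U = 1` are trivially bi-contractive. [cite: Balaban1985BackgroundPropagators, Cor. 3.5 p.407 («U = 1»), bookkeeping] -/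
theorem parSymY_one_contractive : ∀ z w : SiteY i, ‖((parSymY i (fun _ _ => (1 : 𝔸ˣ)) z w : 𝔸ˣ) : 𝔸)‖ ≤ 1 ∧
    ‖(((parSymY i (fun _ _ => (1 : 𝔸ˣ)) z w)⁻¹ : 𝔸ˣ) : 𝔸)‖ ≤ 1 := fun z w => by
  rw [parSymY_one i z w, inv_one, Units.val_one]
  exact ⟨norm_one.le, norm_one.le⟩

/-- ★ **`conjHom b(Q′_□(Ṽ_□)|_ℝ) ≺ M₂Σ‖b‖(1 + τ)·𝟙`** from `Q′_□(Ṽ_□) = Q′_□(1) + F′₂` with the pointwise (3.59) size `τ` of `F′₂` (E2-4a at `U = 1` + E2-4c) — no transporter of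
`Ṽ_□` enters. [cite: Balaban1985BackgroundPropagators, (3.57) p.401, (3.59) p.402, (3.21) p.394, Cor. 3.6 p.408; Balaban1984PropagatorsII, (2.51) p.232] -/
theorem hasMajorantHom_conjHom_QpCubeY_of_size {M₂ : ℝ} (hM₂ : 0 ≤ M₂) (hrepr : ∀ (v : 𝔸) (j : ι), |b.repr v j| ≤ M₂ * ‖v‖) (V : CfgY 𝔸 i)
    {τ : ℝ} (hτ : 0 ≤ τ)
    (hF : ∀ (s : BlkCubeY i c) (lam : SiteY i → 𝔸),
      ‖(QpCubeY i c (parSymY i) V lam - QpCubeY i c (parSymY i) (fun _ _ => 1) lam) s‖ ≤ τ * ∑ z, |qpKc i c s z| * ‖lam z‖) :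
    HasMajorantHom (g := toB6 (geoCK i c) Rr Hp) (fun p : SiteY i × ι => blkCubeY i c p.1) (fun q : BlkCubeY i c × ι => q.1)
      (conjHom b ((QpCubeY i c (parSymY i) V).restrictScalars ℝ)) (fun a a' : BlkCubeY i c => if a = a' then M₂ * (∑ j, ‖b j‖) * (1 + τ) else 0) := by
  rw [conjHom_restrictScalars_eq_add b (QpCubeY i c (parSymY i) V) (QpCubeY i c (parSymY i) (fun _ _ => 1))]
  refine hasMajorantHom_mono (g := toB6 (geoCK i c) Rr Hp) _ _
    (hasMajorantHom_add (g := toB6 (geoCK i c) Rr Hp) _ _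
      (hasMajorantHom_conjHom_QpCubeY i c b (parSymY i) (fun _ _ => 1) (Rr := Rr) (Hp := Hp) (parSymY_one_contractive i) hM₂ hrepr)
      (hasMajorantHom_conjHom_QpCubeY_sub i c b (parSymY i) V (fun _ _ => 1) (Rr := Rr) (Hp := Hp) hM₂ hrepr hτ hF)) fun a a' => ?_
  split_ifs <;> simp only [add_zero, le_refl, mul_add, mul_one]

/-- ★ the same for `Q′_□*(Ṽ_□)`. [cite: Balaban1985BackgroundPropagators, (3.57) p.401, (3.59) p.402, (3.24) p.394, Cor. 3.6 p.408; Balaban1984PropagatorsII, (2.51) p.232] -/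
theorem hasMajorantHom_conjHom_QpsCubeY_of_size {M₂ : ℝ} (hM₂ : 0 ≤ M₂) (hrepr : ∀ (v : 𝔸) (j : ι), |b.repr v j| ≤ M₂ * ‖v‖) (V : CfgY 𝔸 i)
    {τ : ℝ} (hτ : 0 ≤ τ)
    (hFs : ∀ (z : SiteY i) (nu : BlkCubeY i c → 𝔸),
      ‖(QpsCubeY i c (parSymY i) V nu - QpsCubeY i c (parSymY i) (fun _ _ => 1) nu) z‖ ≤ τ * ∑ s, |qpsKc i c z s| * ‖nu s‖) :
    HasMajorantHom (g := toB6 (geoCK i c) Rr Hp) (fun q : BlkCubeY i c × ι => q.1) (fun p : SiteY i × ι => blkCubeY i c p.1)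
      (conjHom b ((QpsCubeY i c (parSymY i) V).restrictScalars ℝ)) (fun a a' : BlkCubeY i c => if a = a' then M₂ * (∑ j, ‖b j‖) * (1 + τ) else 0) := by
  rw [conjHom_restrictScalars_eq_add b (QpsCubeY i c (parSymY i) V) (QpsCubeY i c (parSymY i) (fun _ _ => 1))]
  refine hasMajorantHom_mono (g := toB6 (geoCK i c) Rr Hp) _ _
    (hasMajorantHom_add (g := toB6 (geoCK i c) Rr Hp) _ _
      (hasMajorantHom_conjHom_QpsCubeY i c b (parSymY i) (fun _ _ => 1) (Rr := Rr) (Hp := Hp) (parSymY_one_contractive i) hM₂ hrepr)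
      (hasMajorantHom_conjHom_QpsCubeY_sub i c b (parSymY i) V (fun _ _ => 1) (Rr := Rr) (Hp := Hp) hM₂ hrepr hτ hFs)) fun a a' => ?_
  split_ifs <;> simp only [add_zero, le_refl, mul_add, mul_one]

end QLetters

/-! ## §2 ★★★ Corollary 3.6 for `C_□` at the localised field of the (3.35) datum -/

section AtDatum

variable [NormOneClass 𝔸] [DecidableEq ι]

/-- ★★★ **COROLLARY 3.5 ∕ 3.6 FOR THE CUBE LETTER `C_□ = (Q′_□G′_□²Q′_□*)⁻¹` AT THE LOCALISED FIELD `Ṽ_□ = e^{iηχ̃_□A}·1` OF THE (3.35) DATUM**, uniformly in the member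
and the cover cube: there are `δ, B > 0`, thresholds `M₀, T₀, N₀` and Theorem 3.4's `a₁ > 0` (functions of `d, L`, the basis datum `M₂`) such that for every member above
the thresholds, every cover cube `□`, every letter `Rr, H` of the target geometry and every potential `A` on a torus set `Q ⊇ {within 4.375S_j + 1 of the centre}` with
`‖A‖ ≤ Cξ⁻¹`, `‖η⁻¹∂A‖ ≤ Cξ⁻²` there, a datum scale `0 < ξ ≤ 5S_jη` with `L^{j+1}η ≤ Λξ`, `1 ≤ Λ`, and the (3.37) size `α₁ := max C (C(1+D₁θ))·Λ² ≤ min(a₁, 1/4)`: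
(i) the cube operator `X̂_□(Ṽ_□) = (Q′_□G′_□²Q′_□*)(Ṽ_□)` at def-Y's `parSymY` IS A UNIT and its inverse in print's units has the Theorem-3.2 block majorant
`conj b(η⁻⁴·C_□(Ṽ_□)|_ℝ) ≺ B·ℓ(a)^{−4}·e^{−δd(a,a′)}` over `(toB6 (geoCK i □) Rr H, Prod.fst)` — E2-4d's `cor35_Cinv_cube` with its nine `A`-readings DISCHARGED from the
datum in currency A (p33's `readings337_locFld`, `ownLevel_of_blockwise`, `norm_kFCubeY_parSymY_le ∕ norm_sFCubeY_parSymY_le`; r05's `norm_QpCubeY_prod_sub_apply_le ∕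
norm_QpsCubeY_prod_sub_apply_le`) — and (ii) the block-local two-space majorants `conjHom b(Q′_□(Ṽ_□)|_ℝ), conjHom b(Q′_□*(Ṽ_□)|_ℝ) ≺ M₂Σ‖b‖(1 + C_q α₁)·𝟙` (§1).  NO
unitarity of `Ṽ_□` is assumed (print: «U′ satisfies (3.37) … with U = 1 and α₁ = O(1)Mα₀»).
[cite: Balaban1985BackgroundPropagators, Cor. 3.5 p.407, Cor. 3.6 p.408, Thm 3.4 p.400, p.403 l.8–12, Thm 3.2 (3.48) p.398, (3.57)–(3.60) pp.401–402, (3.35)–(3.37) p.396, p.409 l.1–5; Balaban1984PropagatorsII, Prop. 2.3 (2.86)–(2.87) p.238] -/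
theorem cinv_cube_at_locCfg (d ℓ : ℕ) (hℓ : 1 ≤ ℓ) (M₂ : ℝ) (hM₂ : 0 ≤ M₂) (hrepr : ∀ (v : 𝔸) (j : ι), |b.repr v j| ≤ M₂ * ‖v‖) :
    ∃ δ B M₀ T₀ : ℝ, ∃ N₀ : ℕ, 0 < δ ∧ 0 < B ∧ ∃ a₁ : ℝ, 0 < a₁ ∧
    ∀ {hd : 1 ≤ d + 1} {hL : Odd (ℓ + 1) ∧ 1 < ℓ + 1} {b₀ b₁ : ℝ} (i : KIdx d ℓ hd hL b₀ b₁) (c : ↥(cubes (toKT i).D.toDomains)) (Rr : ℝ) (H : Prop),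
      M₀ ≤ ((ℓ : ℝ) + 1) * (toKT i).Mh → N₀ + 1 ≤ (toKT i).R * ((ℓ + 1) * (toKT i).Mh) → T₀ ≤ RM1 i →
    ∀ (A : AfldY 𝔸 i) (Q : Set (Site (PV d ℓ i.m i.K hd hL) 0)) (C ξ Λ : ℝ),
      0 ≤ C → 0 < ξ → 1 ≤ Λ → ξ ≤ 5 * (SC i c : ℝ) * (kGeo i).eta → LatticeNorms.scaleLen ((ℓ : ℝ) + 1) (kGeo i).eta (c.1.1 + 1) ≤ Λ * ξ →
      (∀ x : Site (PV d ℓ i.m i.K hd hL) 0, NearC i c (35 * SC i c / 8 + 1) (boxEquiv i.hN x).1 → x ∈ Q) →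
      (∀ κ, ∀ x ∈ Q, ‖A κ x‖ ≤ C * ξ⁻¹) →
      (∀ μ ν, ∀ x ∈ Q, ‖(((kGeo i).eta : ℂ)⁻¹) • covD (shiftsV1 (PV d ℓ i.m i.K hd hL)) (fun _ _ => (1 : 𝔸ˣ)) μ (A ν) x‖ ≤ C * (ξ ^ 2)⁻¹) →
      max C (C * (1 + D1 thetaProf)) * Λ ^ 2 ≤ a₁ → max C (C * (1 + D1 thetaProf)) * Λ ^ 2 ≤ 1 / 4 →
      (IsUnit (XCubeY i c (parSymY i) (locCfgY i c (kGeo i).eta A)) ∧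
        HasMajorant (g := toB6 (geoCK i c) Rr H) (fun q : BlkCubeY i c × ι => q.1)
          (conj b ((((kGeo i).eta ^ 4)⁻¹) • (XinvCubeY i c (parSymY i) (locCfgY i c (kGeo i).eta A)).restrictScalars ℝ))
          (fun a a' => B * (geoCK i c).len a ^ (-(4 : ℝ)) * Real.exp (-(δ * (geoCK i c).dist a a')))) ∧
      HasMajorantHom (g := toB6 (geoCK i c) Rr H) (fun p : SiteY i × ι => blkCubeY i c p.1) (fun q : BlkCubeY i c × ι => q.1)
          (conjHom b ((QpCubeY i c (parSymY i) (locCfgY i c (kGeo i).eta A)).restrictScalars ℝ))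
          (fun a a' : BlkCubeY i c => if a = a' then M₂ * (∑ j, ‖b j‖) * (1 + Cq d * (max C (C * (1 + D1 thetaProf)) * Λ ^ 2)) else 0) ∧
      HasMajorantHom (g := toB6 (geoCK i c) Rr H) (fun q : BlkCubeY i c × ι => q.1) (fun p : SiteY i × ι => blkCubeY i c p.1)
          (conjHom b ((QpsCubeY i c (parSymY i) (locCfgY i c (kGeo i).eta A)).restrictScalars ℝ))
          (fun a a' : BlkCubeY i c => if a = a' then M₂ * (∑ j, ‖b j‖) * (1 + Cq d * (max C (C * (1 + D1 thetaProf)) * Λ ^ 2)) else 0) := by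
  have h1A : ‖(1 : 𝔸)‖ ≤ 1 := norm_one.le
  obtain ⟨δ, B, M₀, T₀, N₀, hδ, hB, a₁, ha₁, Hmain⟩ := cor35_Cinv_cube b d ℓ hℓ (Cq d) M₂ (Cq_nonneg d) hM₂ hrepr h1A
  refine ⟨δ, B, M₀, T₀, N₀, hδ, hB, a₁, ha₁, ?_⟩
  intro hd hL b₀ b₁ i c Rr H hM hN hT A Q C ξ Λ hC hξ hΛ hξS hΛξ hQ hA hdA hα₁ hα4
  set η : ℝ := (kGeo i).eta with hηdef
  have hη : 0 < η := by rw [hηdef, ← geoCK_eta i c]; exact geoCK_eta_pos i c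
  set α₁ : ℝ := max C (C * (1 + D1 thetaProf)) * Λ ^ 2 with hα₁def
  have hα₁0 : 0 ≤ α₁ := by
    rw [hα₁def]; exact mul_nonneg (le_max_of_le_left hC) (sq_nonneg _)
  -- the length function at the cube blocks is `L^{n(z)}η`
  have hL1 : (1 : ℝ) ≤ (ℓ : ℝ) + 1 := by linarith [(Nat.cast_nonneg ℓ : (0 : ℝ) ≤ ℓ)]
  have hlenS : ∀ z : SiteY i, (geoCK i c).len (blkCubeY i c z) = LatticeNorms.scaleLen ((ℓ : ℝ) + 1) η (levCubeY i c z) := fun z => by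
    rw [(geoCK_len_blkCubeY i c z).1]; rfl
  have hlen : ∀ z : SiteY i, 0 < (geoCK i c).len (blkCubeY i c z) := fun z => by
    rw [hlenS]; exact (scaleLen_levCubeY_bounds i c hL1 hη hΛξ z).1
  have hlenΛ : ∀ z : SiteY i, (geoCK i c).len (blkCubeY i c z) ≤ Λ * ξ := fun z => by
    rw [hlenS]; exact (scaleLen_levCubeY_bounds i c hL1 hη hΛξ z).2
  -- the five (3.37) readings of the cut field (p33 FILE 4)
  obtain ⟨r1, r2, r3, r4, r5⟩ := readings337_locFld i c hC hη hξ hΛ hξS hQ hA hdA (fun z => (geoCK i c).len (blkCubeY i c z)) hlen hlenΛ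
  -- the (3.59) kernel sizes (currency A at the base `1`, `G := ⊥`)
  have hG1 : ∀ u : 𝔸ˣ, u ∈ (⊥ : Subgroup 𝔸ˣ) → ‖(u : 𝔸)‖ ≤ 1 := fun u hu => by
    rw [Subgroup.mem_bot] at hu; rw [hu, Units.val_one]; exact h1A
  have hU1 : ∀ (μ : Fin (d + 1)) (x : Site (PV d ℓ i.m i.K hd hL) 0), ((fun _ _ => (1 : 𝔸ˣ)) : CfgY 𝔸 i) μ x ∈ (⊥ : Subgroup 𝔸ˣ) :=
    fun _ _ => Subgroup.one_mem _
  have hown := ownLevel_of_blockwise i c hη (cutFldY i (chiTY i c) A) (α₁ := α₁) (fun k x => by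
    have h := r4 k x
    rw [(geoCK_len_blkCubeY i c x).1, levCubeY_eq] at h
    push_cast
    exact h)
  have hkF : ∀ (y : BlkCubeY i c) (x : SiteY i), blkCubeY i c x = y →
      ‖kFCubeY i c (parSymY i) (fun _ _ => 1) (locCfgY i c η A) y x‖ ≤ Cq d * α₁ * B9Cor35GpCubeInputsAtOne.wK i c y :=
    fun y x hx => norm_kFCubeY_parSymY_le i c ⊥ hG1 hU1 hη.le (cutFldY i (chiTY i c) A) y hα₁0 hα4 (hown y) x hx
  have hsF : ∀ x : SiteY i, ‖sFCubeY i c (parSymY i) (fun _ _ => 1) (locCfgY i c η A) x‖ ≤ Cq d * α₁ :=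
    fun x => norm_sFCubeY_parSymY_le i c ⊥ hG1 hU1 hη.le (cutFldY i (chiTY i c) A) x hα₁0 hα4 (hown (blkCubeY i c x))
  -- the two pointwise (3.59) sizes of `Q′_□(Ṽ) − Q′_□(1)`, `Q′_□*(Ṽ) − Q′_□*(1)` (r05, currency A — no unitarity of `Ṽ`)
  have hF : ∀ (s : BlkCubeY i c) (lam : SiteY i → 𝔸),
      ‖(QpCubeY i c (parSymY i) (locCfgY i c η A) lam - QpCubeY i c (parSymY i) (fun _ _ => 1) lam) s‖ ≤ Cq d * α₁ * ∑ z, |qpKc i c s z| * ‖lam z‖ :=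
    fun s lam => norm_QpCubeY_prod_sub_apply_le i c ⊥ hG1 hU1 hη.le (cutFldY i (chiTY i c) A) s hα₁0 hα4 (hown s) lam
  have hFs : ∀ (z : SiteY i) (nu : BlkCubeY i c → 𝔸),
      ‖(QpsCubeY i c (parSymY i) (locCfgY i c η A) nu - QpsCubeY i c (parSymY i) (fun _ _ => 1) nu) z‖ ≤ Cq d * α₁ * ∑ s, |qpsKc i c z s| * ‖nu s‖ :=
    fun z nu => norm_QpsCubeY_prod_sub_apply_le i c ⊥ hG1 hU1 hη.le (cutFldY i (chiTY i c) A) z hα₁0 hα4 (hown (blkCubeY i c z)) nu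
  -- E2-4d at the datum
  have hparone : ∀ z w : SiteY i, parSymY i (fun _ _ => (1 : 𝔸ˣ)) z w = 1 := fun z w => parSymY_one i z w
  have hmain := Hmain i c Rr H (parSymY i) hparone hM hN hT α₁ hα₁0 hα₁ A hkF hsF
    (fun ν k x => by rw [geoCK_eta]; exact r1 ν k x) (fun μ ν x => by rw [geoCK_eta]; exact r2 μ ν x)
    (fun μ x => by rw [geoCK_eta]; exact r3 μ x) r4 r5 hF hFs
  exact ⟨hmain, hasMajorantHom_conjHom_QpCubeY_of_size b i c hM₂ hrepr _ (mul_nonneg (Cq_nonneg d) hα₁0) hF,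
    hasMajorantHom_conjHom_QpsCubeY_of_size b i c hM₂ hrepr _ (mul_nonneg (Cq_nonneg d) hα₁0) hFs⟩

end AtDatum

end Literature.MathematicalPhysics.QuantumFieldTheory.Balaban1983to89.B9Cor36CinvCubeAtLocCfg

end
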